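import Literature.Barriers.QuantumAdvantage.UncorrectedNoiseMachineSample
import Literature.Computability.Cryptography.OneWayFunctions
import HarnessLib

/-!
# The noisy-IQP simulating machine, VI: the run function, the `RandAlg`, polynomial time, and the coin count of a step

Support file for the discharge of `bremnerMontanaroShepherd2017_thm4`
(`Literature/Barriers/QuantumAdvantage/UncorrectedNoise.lean`), Bremner–Montanaro–Shepherd
2017, Theorem 4: the complete simulating machine assembled from `UncorrectedNoiseMachineSample`
(table + sequential sampler) behind a context builder reading the uniform description of the
IQP family (`QuantumCircuitDescFP.descFn`):

* `runFn desc ℓ P C R2 m₀` (`∈ FP` for `desc ∈ FP`), its value for an `IQPFamily`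
  (`runFn_apply = sampleRun …` of length `N = width F n = n + ancillas n`), the `RandAlg`
  `sampler F ℓ P C R2 m₀` with `N (N + m₀)` coins, and **`sampler_isPPT`** (from uniformity,
  exactly as `Cryptography/YaoInvProgram.yaoRun_polyTime_holds`, with the width bound
  `exists_poly_width_le` from the halting rule);
* the dyadic rounding `roundUp m t = ⌈2^m t⌉/2^m` (`roundingOK_roundUp`, `abs_roundUp_sub_le`) and
  **`card_decBit_false`**: among the `2^m` coin-block values, the decision of
  `UncorrectedNoiseMachineSample.decBit` appends `0` on exactly `⌈2^m · branchWeight T0 T1⌉` of them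
  (the step rule of §3.2 realised with fair coins); `card_filter_blocks_eq` transports counts over
  blocks `Fin m → Bool` to counts over `range (2^m)` (`bitsToNat ∘ ofFn` is a bijection).

## References

* [BremnerMontanaroShepherd2017] M. J. Bremner, A. Montanaro, D. J. Shepherd, *Achieving quantum
  supremacy with sparse and noisy commuting quantum computations*, Quantum 1 (2017) 8, Thm 4, §3.2.
-/

namespace Literature.Barriers.QuantumAdvantage.NoisyIQPMachine

open _root_.Computability Literature.Computability.Complexity Literature.Computability.Complexity.Brick
  Literature.Computability.Complexity.Plumb Literature.Computability.Cryptography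

/-! ### The run function: context from the description, table, sampling loop -/

section Run

variable (desc : List Bool → List Bool) (ℓ P : ℕ) (C : ℕ → ℕ) (R2 m₀ : ℕ)

/-- `1^N` from the input: `1^{|x|} ++ (unary ancilla count read off the description)`. [folklore] -/
noncomputable def onesNFn : List Bool → List Bool := fun x => onesFn x ++ (nthF 1 ∘ desc) x

/-- `onesNFn ∈ FP` for `desc ∈ FP`. [folklore] -/
theorem onesNFn_mem_FP (hdesc : desc ∈ FP) : onesNFn desc ∈ FP :=
  append_mem_FP onesFn_mem_FP (comp_mem_FP (nthF_mem_FP 1) hdesc)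

/-- The coefficient context `⟨x, ⟨1^N, G⟩⟩` from the input `x`. [folklore] -/
noncomputable def ctxQFn : List Bool → List Bool := fanoutFn id (fanoutFn (onesNFn desc) (sndPow 1 ∘ desc))

/-- `ctxQFn ∈ FP`. [folklore] -/
theorem ctxQFn_mem_FP (hdesc : desc ∈ FP) : ctxQFn desc ∈ FP :=
  fanoutFn_mem_FP OracleCompose.id_mem_FP (fanoutFn_mem_FP (onesNFn_mem_FP desc hdesc) (comp_mem_FP (sndPow_mem_FP 1) hdesc))

/-- The sampling data record `⟨r, ⟨1^N, ⟨1^{N+m₀}, table⟩⟩⟩` from the machine input `⟨x, r⟩`. [folklore] -/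
noncomputable def xsFn : List Bool → List Bool :=
  fanoutFn sndF (fanoutFn (onesNFn desc ∘ fstF) (fanoutFn (fun w => onesNFn desc (fstF w) ++ ones m₀)
    (tableFn ℓ P C R2 (cellK ℓ P C R2) ∘ ctxQFn desc ∘ fstF)))

/-- `xsFn ∈ FP`. [folklore] -/
theorem xsFn_mem_FP (hdesc : desc ∈ FP) : xsFn desc ℓ P C R2 m₀ ∈ FP :=
  fanoutFn_mem_FP sndF_mem_FP (fanoutFn_mem_FP (comp_mem_FP (onesNFn_mem_FP desc hdesc) fstF_mem_FP)
    (fanoutFn_mem_FP (append_mem_FP (comp_mem_FP (onesNFn_mem_FP desc hdesc) fstF_mem_FP) (const_mem_FP _))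
      (comp_mem_FP (tableFn_mem_FP ℓ P C R2 _) (comp_mem_FP (ctxQFn_mem_FP desc hdesc) fstF_mem_FP))))

/-- **The run function of the simulating machine** on `⟨x, r⟩`: build the table, then sample.
[cite: BremnerMontanaroShepherd2017, Thm 4 (proof, §3: "The overall algorithm starts by approximating and storing enough Fourier coefficients … Then each sample … can be produced in time poly(n)")] -/
noncomputable def runFn : List Bool → List Bool := sampLoopFn ∘ xsFn desc ℓ P C R2 m₀

/-- **`runFn ∈ FP`** for a polynomial-time description function. [cite: BremnerMontanaroShepherd2017, Thm 4 (running time n^{O(log(α/δ)/ε)})] -/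
theorem runFn_mem_FP (hdesc : desc ∈ FP) : runFn desc ℓ P C R2 m₀ ∈ FP :=
  comp_mem_FP sampLoopFn_mem_FP (xsFn_mem_FP desc ℓ P C R2 m₀ hdesc)

end Run

/-! ### Values for an IQP family -/

section Family

variable (F : IQPFamily) (ℓ P : ℕ) (C : ℕ → ℕ) (R2 m₀ : ℕ)

/-- The width `N = n + ancillas n` (an `abbrev`, so that `QGate iqpDiag (width F n)` is the type of
the family's gates). [folklore] -/
abbrev width (n : ℕ) : ℕ := n + F.ancillas n

/-- The description function of the family reads `⟨bin n, ⟨1^{anc n}, encList (gate codes)⟩⟩` on any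
input of length `n`. [folklore] -/
theorem descFn_apply (x : List Bool) : F.toQCircuitFamily.descFn x =
    boolPair (encodeNat x.length) (boolPair (ones (F.ancillas x.length))
      (encList ((F.diag x.length).gates.map QGate.encode))) := by
  rw [QCircuitFamily.descFn_eq, unaryEncodeNat_eq_replicate, QCircuit.encode_eq_encList]; rfl

/-- `onesNFn` gives `1^N`. [folklore] -/
theorem onesNFn_apply (x : List Bool) : onesNFn F.toQCircuitFamily.descFn x = ones (width F x.length) := by
  rw [onesNFn, Function.comp_apply, descFn_apply, onesFn, unaryEncodeNat_eq_replicate]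
  simp [nthF, ones]

/-- `ctxQFn` gives the coefficient context of `UncorrectedNoiseMachineSample`. [folklore] -/
theorem ctxQFn_apply (x : List Bool) : ctxQFn F.toQCircuitFamily.descFn x =
    ctxQ x (width F x.length) (encList ((F.diag x.length).gates.map QGate.encode)) := by
  rw [ctxQFn, fanoutFn_apply, fanoutFn_apply, onesNFn_apply, Function.comp_apply, descFn_apply]
  simp [ctxQ, sndPow]

/-- `xsFn` gives the sampling record with the coefficient table. [folklore] -/
theorem xsFn_apply (x r : List Bool) : xsFn F.toQCircuitFamily.descFn ℓ P C R2 m₀ (boolPair x r) =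
    sxs r (width F x.length) (width F x.length + m₀)
      (encList (tableList (N := width F x.length) ℓ P C R2 x (F.diag x.length).gates)) := by
  rw [xsFn, fanoutFn_apply, fanoutFn_apply, fanoutFn_apply, sndF_boolPair, Function.comp_apply, fstF_boolPair, onesNFn_apply,
    Function.comp_apply, Function.comp_apply, fstF_boolPair, ctxQFn_apply,
    tableFn_cellK_apply ℓ P C R2 x (show x.length ≤ x.length + F.ancillas x.length by omega) _]
  simp [sxs, ones]

/-- **Value of the run function**: the sampled string `sampleRun` of length `N`.
[cite: BremnerMontanaroShepherd2017, §3.2 (the procedure defining Alg)] -/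
theorem runFn_apply (x r : List Bool) : runFn F.toQCircuitFamily.descFn ℓ P C R2 m₀ (boolPair x r) =
    sampleRun (N := width F x.length) ℓ P C R2 x (F.diag x.length).gates r (width F x.length + m₀) (width F x.length) := by
  rw [runFn, Function.comp_apply, xsFn_apply, sampLoopFn_apply]

/-- The output has length `N`. [folklore] -/
theorem length_runFn (x r : List Bool) : (runFn F.toQCircuitFamily.descFn ℓ P C R2 m₀ (boolPair x r)).length = width F x.length := by
  rw [runFn_apply, length_sampleRun]

/-! ### The randomized algorithm and its efficiency -/

/-- **The classical sampler** of Theorem 4 as a `RandAlg`: `N·(N+m₀)` coins on inputs of length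
`n` (`m = N + m₀` fair coins per output bit). [cite: BremnerMontanaroShepherd2017, Thm 4] -/
noncomputable def sampler : RandAlg (List Bool) (List Bool) where
  run x r := runFn F.toQCircuitFamily.descFn ℓ P C R2 m₀ (boolPair x r)
  coinLen n := width F n * (width F n + m₀)

/-- An `FP` function has polynomially bounded output length (the halting rule; private twin of
`OrbitDeciders.exists_poly_length_le` / `CountingHierarchyProofs.exists_poly_length_le_of_mem_FP`,
neither in this closure). [folklore] -/
private theorem exists_poly_length_le' {f : List Bool → List Bool} (hf : f ∈ FP) :
    ∃ q : Polynomial ℕ, ∀ x, (f x).length ≤ q.eval x.length := by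
  obtain ⟨p, M, hM⟩ := hf
  refine ⟨Polynomial.X + Polynomial.C (TM2Comp.machinePushBound M.tm) * p, fun x => ?_⟩
  have h := (hM x).length_le
  simpa using h

/-- The width of a uniform family is polynomially bounded. [folklore] -/
theorem exists_poly_width_le (hF : F.IsUniform) : ∃ q : Polynomial ℕ, ∀ n, width F n ≤ q.eval n := by
  have hdesc : F.toQCircuitFamily.descFn ∈ FP := (QCircuitFamily.isUniform_iff_descFn_mem_FP _).1 hF
  obtain ⟨q, hq⟩ := exists_poly_length_le' hdesc
  refine ⟨Polynomial.X + q, fun n => ?_⟩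
  have h := hq (ones n)
  rw [descFn_apply, List.length_replicate] at h
  simp only [length_boolPair, List.length_replicate] at h
  simp only [Polynomial.eval_add, Polynomial.eval_X]
  show n + F.ancillas n ≤ _
  omega

/-- **The sampler is probabilistic polynomial-time** for a uniform family.
[cite: BremnerMontanaroShepherd2017, Thm 4 ("in time n^{O(log(α/δ)/ε)} + T poly(n)")] -/
theorem sampler_isPPT (hF : F.IsUniform) : IsPPT (sampler F ℓ P C R2 m₀) id := by
  have hdesc : F.toQCircuitFamily.descFn ∈ FP := (QCircuitFamily.isUniform_iff_descFn_mem_FP _).1 hF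
  constructor
  · obtain ⟨p, M, hM⟩ := runFn_mem_FP F.toQCircuitFamily.descFn ℓ P C R2 m₀ hdesc
    refine ⟨p, M, fun q => ?_⟩
    have h := hM (boolPair q.1 q.2)
    exact h
  · obtain ⟨q, hq⟩ := exists_poly_width_le F hF
    refine ⟨q * (q + Polynomial.C m₀), fun n => ?_⟩
    show width F n * (width F n + m₀) ≤ _
    rw [Polynomial.eval_mul, Polynomial.eval_add, Polynomial.eval_C]
    exact Nat.mul_le_mul (hq n) (Nat.add_le_add_right (hq n) _)

end Family

end Literature.Barriers.QuantumAdvantage.NoisyIQPMachine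

namespace Literature.Barriers.QuantumAdvantage.NoisyIQPMachine

open Finset _root_.Computability Literature.Computability.Complexity Literature.Computability.Cryptography

/-! ### Counting the coin blocks of one decision

The decision `decBit m T0 T1 u` appends `0` exactly on `⌈2^m · branchWeight T0 T1⌉` of the `2^m`
coin blocks: the rounding `R_m t = ⌈2^m t⌉/2^m` of `UncorrectedNoiseSampling.algR`. -/

/-- The dyadic up-rounding `R_m t = ⌈2^m t⌉₊ / 2^m`. [folklore] -/
noncomputable def roundUp (m : ℕ) (t : ℝ) : ℝ := (⌈(2 : ℝ) ^ m * t⌉₊ : ℝ) / 2 ^ m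

/-- `R_m` keeps `[0,1]`. [folklore] -/
theorem roundingOK_roundUp (m : ℕ) : RoundingOK (roundUp m) := by
  intro t h0 h1
  have h2 : (0 : ℝ) < 2 ^ m := by positivity
  unfold roundUp
  refine ⟨by positivity, ?_⟩
  rw [div_le_one h2]
  have : (⌈(2 : ℝ) ^ m * t⌉₊ : ℝ) ≤ ((2 ^ m : ℕ) : ℝ) := by
    exact_mod_cast Nat.ceil_le.2 (by push_cast; nlinarith)
  simpa using this

/-- `|R_m t − t| ≤ 2^{-m}` on `[0,1]`. [folklore] -/
theorem abs_roundUp_sub_le (m : ℕ) (t : ℝ) (h0 : 0 ≤ t) (_h1 : t ≤ 1) : |roundUp m t - t| ≤ 1 / 2 ^ m := by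
  have h2 : (0 : ℝ) < 2 ^ m := by positivity
  unfold roundUp
  have hc1 : (2 : ℝ) ^ m * t ≤ ⌈(2 : ℝ) ^ m * t⌉₊ := Nat.le_ceil _
  have hc2 : (⌈(2 : ℝ) ^ m * t⌉₊ : ℝ) < 2 ^ m * t + 1 := Nat.ceil_lt_add_one (by positivity)
  rw [abs_le]
  constructor
  · have : t - 1 / 2 ^ m ≤ (⌈(2 : ℝ) ^ m * t⌉₊ : ℝ) / 2 ^ m := by
      rw [le_div_iff₀ h2, sub_mul, div_mul_cancel₀ _ h2.ne']; nlinarith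
    linarith
  · have : (⌈(2 : ℝ) ^ m * t⌉₊ : ℝ) / 2 ^ m ≤ t + 1 / 2 ^ m := by
      rw [div_le_iff₀ h2, add_mul, div_mul_cancel₀ _ h2.ne']; nlinarith
    linarith

/-- The number of naturals below a nonnegative real bound `x ≤ M` among `0, …, M−1` is `⌈x⌉`. [folklore] -/
theorem card_filter_lt_real {M : ℕ} {x : ℝ} (_hx0 : 0 ≤ x) (hxM : x ≤ M) :
    ((Finset.range M).filter fun u : ℕ => (u : ℝ) < x).card = ⌈x⌉₊ := by
  have hsub : (Finset.range M).filter (fun u : ℕ => (u : ℝ) < x) = Finset.range ⌈x⌉₊ := by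
    ext u
    simp only [Finset.mem_filter, Finset.mem_range, Nat.lt_ceil]
    constructor
    · exact fun h => h.2
    · intro h
      refine ⟨?_, h⟩
      have : (u : ℝ) < M := h.trans_le hxM
      exact_mod_cast this
  rw [hsub, Finset.card_range]

/-- **Counting the blocks that append `0`**: `#{u < 2^m : decBit m T0 T1 u = 0} = ⌈2^m · branchWeight T0 T1⌉`.
[cite: BremnerMontanaroShepherd2017, §3.2 (step 2(b), realised with fair coins)] -/
theorem card_decBit_false (m : ℕ) (t0 t1 : ℤ) :
    ((Finset.range (2 ^ m)).filter fun u => decBit m t0 t1 u = false).card =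
      ⌈(2 : ℝ) ^ m * branchWeight t0 t1⌉₊ := by
  unfold decBit branchWeight
  by_cases h0 : t0 < 0
  · have h0' : (t0 : ℝ) < 0 := by exact_mod_cast h0
    simp [h0, h0']
  have h0' : ¬ (t0 : ℝ) < 0 := by exact_mod_cast h0
  rw [if_neg h0']
  by_cases h1 : t1 < 0
  · have h1' : (t1 : ℝ) < 0 := by exact_mod_cast h1
    rw [if_pos h1', mul_one]
    rw [Finset.filter_true_of_mem (fun u _ => by rw [if_neg h0, if_pos h1]), Finset.card_range]
    exact_mod_cast (Nat.ceil_natCast (2 ^ m)).symm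
  have h1' : ¬ (t1 : ℝ) < 0 := by exact_mod_cast h1
  rw [if_neg h1']
  push Not at h0 h1
  rcases (add_nonneg h0 h1).eq_or_lt with hs | hs
  · -- `t0 = t1 = 0`: the bit is always `1`
    have ht0 : t0 = 0 := by linarith
    have ht1 : t1 = 0 := by linarith
    subst ht0; subst ht1
    simp
  · have hsR : (0 : ℝ) < (t0 : ℝ) + t1 := by exact_mod_cast hs
    have hkey : ∀ u : ℕ, (decide (2 ^ m * t0 ≤ (u : ℤ) * (t0 + t1)) = false) ↔ ((u : ℝ) < 2 ^ m * (t0 / (t0 + t1))) := by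
      intro u
      rw [decide_eq_false_iff_not, not_le, mul_div_assoc', lt_div_iff₀ hsR]
      constructor
      · intro h; exact_mod_cast h
      · intro h; exact_mod_cast h
    have hfilt : (Finset.range (2 ^ m)).filter (fun u : ℕ => (if t0 < 0 then true else if t1 < 0 then false
        else decide (2 ^ m * t0 ≤ (u : ℤ) * (t0 + t1))) = false) =
        (Finset.range (2 ^ m)).filter (fun u : ℕ => (u : ℝ) < 2 ^ m * (t0 / (t0 + t1))) := by
      refine Finset.filter_congr fun u _ => ?_
      rw [if_neg (not_lt.2 h0), if_neg (not_lt.2 h1)]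
      exact hkey u
    rw [hfilt]
    refine card_filter_lt_real (by positivity) ?_
    push_cast
    have : (t0 : ℝ) / (t0 + t1) ≤ 1 := by rw [div_le_one hsR]; linarith [show (0:ℝ) ≤ t1 by exact_mod_cast h1]
    nlinarith [show (0:ℝ) < 2 ^ m by positivity]

/-- Strings of equal length with equal value are equal. [folklore] -/
theorem bitsToNat_inj_of_length_eq : ∀ {u v : List Bool}, u.length = v.length → bitsToNat u = bitsToNat v → u = v
  | [], [], _, _ => rfl
  | [], _ :: _, h, _ => by simp at h
  | _ :: _, [], h, _ => by simp at h
  | a :: u, b :: v, hl, hv => by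
    simp only [List.length_cons, Nat.add_right_cancel_iff] at hl
    rw [bitsToNat_cons, bitsToNat_cons] at hv
    have hab : a = b := by
      cases a <;> cases b <;> simp [Bool.toNat] at hv ⊢ <;> omega
    subst hab
    have huv : bitsToNat u = bitsToNat v := by omega
    rw [bitsToNat_inj_of_length_eq hl huv]

/-- `bitsToNat ∘ ofFn` is injective on blocks. [folklore] -/
theorem bitsToNat_ofFn_injective (m : ℕ) : Function.Injective fun blk : Fin m → Bool => bitsToNat (List.ofFn blk) := by
  intro a b h
  exact List.ofFn_injective (bitsToNat_inj_of_length_eq (by simp) h)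

/-- The block values are the numbers below `2^m`, each once: summing over blocks is summing over
`range (2^m)`. [folklore] -/
theorem card_filter_blocks_eq (m : ℕ) (p : ℕ → Prop) [DecidablePred p] :
    ((Finset.univ : Finset (Fin m → Bool)).filter fun blk => p (bitsToNat (List.ofFn blk))).card =
      ((Finset.range (2 ^ m)).filter p).card := by
  classical
  set f : (Fin m → Bool) → ℕ := fun blk => bitsToNat (List.ofFn blk) with hf
  have hinj : Function.Injective f := bitsToNat_ofFn_injective m
  have himg : (Finset.univ : Finset (Fin m → Bool)).image f = Finset.range (2 ^ m) := by
    apply Finset.eq_of_subset_of_card_le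
    · intro v hv
      obtain ⟨blk, -, rfl⟩ := Finset.mem_image.1 hv
      rw [Finset.mem_range]
      have := bitsToNat_lt (List.ofFn blk)
      simpa using this
    · rw [Finset.card_range, Finset.card_image_of_injective _ hinj, Finset.card_univ, Fintype.card_fun, Fintype.card_bool,
        Fintype.card_fin]
  rw [← himg, Finset.filter_image, Finset.card_image_of_injective _ hinj]

end Literature.Barriers.QuantumAdvantage.NoisyIQPMachine
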